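/-
Copyright (c) 2026 the pub-hodgecm-mathlib formalisation cell (harness21).  Prover seat hodgecm-mathlib-K2E3-p23 (g5), HCML Track B «K2-LIT» ∕ h413
(`stmt-HodgeConjecture-24833`), line `K2_E3_EllipticInputs`, unit U12 «Characters», road «GL-[M6]-sc» (line lead K2E3-p23 (g5), dealer K2E3-plan (g3)),
MEMO «M6sc-BLUEPRINT v4» §1 (ASM): the `hball` majorant at a SPLIT-regular point of `G' = GL₃(F) ⧸ ϖ^ℤ`.  2026-09-04.
-/
import Summits.HodgeConjecture.HodgeConjecture.Theorems.K2E3GL3ModUniformizerVolumeTransfer     -- ★ «VOL-transfer» p858323 (K2E3-p03 g5): `setIntegral_norm_comp_conj_le_adBall`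
import Summits.HodgeConjecture.HodgeConjecture.Theorems.K2E3GL3SplitConjugacyVolume             -- ★ V4 p858211 (K2E3-p14 g5): `exists_measure_window_adBall_conj_le`
import Summits.HodgeConjecture.HodgeConjecture.Theorems.K2E3GL3TruncatedCharSplitTorusRadius    -- ★ T18-split p858074 (K2E3-p14 g5): `exists_adBall_mul_zpowDiagGL_of_adBall_conj`
import Summits.HodgeConjecture.HodgeConjecture.Theorems.K2E3GL3ConjugacyCountShift               -- ★ p858344 (this seat): the conjugator shift
import Summits.HodgeConjecture.HodgeConjecture.Theorems.K2E3WittLeviCartanBlocks                 -- ★ `zpowDiagGL_mem_standardLeviGL`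
import HarnessLib

/-!
# Road «GL-[M6]-sc», ASM brick: THE BALL BOUND AT A SPLIT-REGULAR POINT —
# `∫_{Ω R} ‖θ(x̄ · mk(y·diag t·y⁻¹) · x̄⁻¹)‖ dμ' ≤ M_θ · (C(m_θ) · 3(2(R + 6s + L)+1)² · |Δ(t)|⁻¹)` (Harish-Chandra 1970, Part VII §3 p. 72 for the split torus)

Cell `pub/hodgecm-mathlib` (D-0151), Track B «K2-LIT», crux H413 = `stmt-HodgeConjecture-24833`, route of record `HCCMUnconditional`.  Lane
`--supports stmt-HodgeConjecture-24833 --as helper`; THEOREMS ONLY (no `def`, no `instance`, no `notation`, no named-fact hypothesis, no `sorry`); count-neutral.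

The `hball` input of ★ ASM-core `K2E3NonEllEstimatesOfRadius.nonEllEstimates_of_radius` at a point `x̄ = mk(y · diag t · y⁻¹)` of `G'` (split-regular: `t_i` pairwise distinct,
integral; the representative of height `s`, `𝔅_s(y diag t y⁻¹)`; `t` of depth `L`), for a bounded `θ` vanishing off `Ω m`:
1. ★ «VOL-transfer»: `∫_{Ω R} ‖θ(x̄ ḡ x̄⁻¹)‖ dμ' ≤ M_θ · (c · ν{h(det z) ∈ [−2,0] ∧ 𝔅_R(z) ∧ 𝔅_m(z g z⁻¹)}).toReal`;
2. ★ T18-split: a conjugator `y′ = y · ϖ^e` of height `6s + L` with `g = y′ · diag t · y′⁻¹`;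
3. ★ shift: `ν{…}(g) ≤ ν{h(det z) ∈ W′ ∧ 𝔅_{R+6s+L}(z) ∧ 𝔅_m(z · diag t · z⁻¹)}`, `|W′| = 3`;
4. ★ V4: `≤ C(m) · 3(2(R+6s+L)+1)² · |Δ(t)|⁻¹`.
* **`exists_setIntegral_norm_conj_le_split`** — the bound, with ONE pair of constants `(c, C)` for all `θ, y, t, s, L, R, m`.
HONEST LABEL: HC_CM is proved only modulo the 7 printed citations (2 remaining named inputs: hLiu418 = stmt-HodgeConjecture-24832, h413 = stmt-HodgeConjecture-24833) until
rung 0 closes; count-neutral helper, closes no socket.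

## References
* [HarishChandra1970] Harish-Chandra (notes by G. van Dijk), *Harmonic Analysis on Reductive p-adic Groups*, LNM 162 (1970), Part VII §2 Theorem 18 p. 69, §3 p. 72.
-/

set_option autoImplicit false
-- the mandated namespace repeats the single-problem summit's segment (`HodgeConjecture.HodgeConjecture`)
set_option linter.dupNamespace false

noncomputable section

open MeasureTheory Measure Set
open scoped MatrixGroups NNReal ENNReal WithZero
open Literature.NumberTheory.Automorphic Literature.NumberTheory.GaloisRepresentations Literature.NumberTheory.GaloisRepresentations.IsNonarchimedeanLocalField
open Summit.HodgeConjecture.HodgeConjecture.Cruxes.H413.K2E3GLnAdHeightBalls Summit.HodgeConjecture.HodgeConjecture.Cruxes.H413.K2E3GL3ModUniformizerFundamentalDomain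
open Summit.HodgeConjecture.HodgeConjecture.Cruxes.H413.K2E3GL3ModUniformizerVolumeTransfer Summit.HodgeConjecture.HodgeConjecture.Cruxes.H413.K2E3GL3SplitConjugacyVolume
open Summit.HodgeConjecture.HodgeConjecture.Cruxes.H413.K2E3GL3TruncatedCharSplitTorusRadius Summit.HodgeConjecture.HodgeConjecture.Cruxes.H413.K2E3GL3ConjugacyCountShift

namespace Summit.HodgeConjecture.HodgeConjecture.Cruxes.H413.K2E3GL3ModUniformizerBallBoundSplit

/-- `ϖ^e` commutes with `diag t`: `y·ϖ^e` still conjugates `diag t` to `y · diag t · y⁻¹`. [folklore] -/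
theorem mul_zpowDiagGL_conj_glDiagonal {F : Type*} [Field F] {ϖ : F} (hϖ0 : ϖ ≠ 0) (y : GL (Fin 3) F) (t : Fin 3 → Fˣ) (e : Fin 3 → ℤ) :
    (y * zpowDiagGL (n := 3) hϖ0 e) * glDiagonal 3 F t * (y * zpowDiagGL (n := 3) hϖ0 e)⁻¹ = y * glDiagonal 3 F t * y⁻¹ := by
  have hcomm : zpowDiagGL (n := 3) hϖ0 e * glDiagonal 3 F t = glDiagonal 3 F t * zpowDiagGL (n := 3) hϖ0 e :=
    mul_comm_of_mem_standardLeviGL_id (K2E3WittLeviCartanBlocks.zpowDiagGL_mem_standardLeviGL (id : Fin 3 → Fin 3) hϖ0 e) (glDiagonal_mem_standardLeviGL_id t)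
  have h1 : (y * zpowDiagGL (n := 3) hϖ0 e) * glDiagonal 3 F t * (y * zpowDiagGL (n := 3) hϖ0 e)⁻¹ =
      y * (zpowDiagGL (n := 3) hϖ0 e * glDiagonal 3 F t * (zpowDiagGL (n := 3) hϖ0 e)⁻¹) * y⁻¹ := by group
  rw [h1, hcomm, mul_inv_cancel_right]

variable {F : Type*} [Field F] [Valued F ℤᵐ⁰] [ValuativeRel F] [(Valued.v : Valuation F ℤᵐ⁰).Compatible] [IsNonarchimedeanLocalField F]
  [MeasurableSpace (GL (Fin 3) F)] [BorelSpace (GL (Fin 3) F)]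
  {ϖ : F} (hϖ : Valued.v ϖ = WithZero.exp (-1 : ℤ)) (hϖ0 : ϖ ≠ 0)
  [((Subgroup.zpowers (Units.mk0 ϖ hϖ0)).map (Matrix.GeneralLinearGroup.scalar (Fin 3))).Normal]
  [MeasurableSpace (GL (Fin 3) F ⧸ (Subgroup.zpowers (Units.mk0 ϖ hϖ0)).map (Matrix.GeneralLinearGroup.scalar (Fin 3)))]
  [BorelSpace (GL (Fin 3) F ⧸ (Subgroup.zpowers (Units.mk0 ϖ hϖ0)).map (Matrix.GeneralLinearGroup.scalar (Fin 3)))]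
  (μ' : Measure (GL (Fin 3) F ⧸ (Subgroup.zpowers (Units.mk0 ϖ hϖ0)).map (Matrix.GeneralLinearGroup.scalar (Fin 3)))) [μ'.IsHaarMeasure]

include hϖ in
/-- **THE BALL BOUND AT A SPLIT-REGULAR POINT.**  There are constants `c : ℝ≥0` and `C : ℕ → ℝ≥0∞` (`C m < ∞`) such that for every bounded `θ` (`‖θ‖ ≤ M_θ`) vanishing off
`Ω m`, every `y`, every `t = (t₀,t₁,t₂)` with pairwise distinct integral entries, every height `s` with `𝔅_s(y · diag t · y⁻¹)`, every depth `L` with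
`|ϖ^L (t₀t₁t₂)²| ≤ |Δ(t)²|`, and every radius `R`:
`∫_{Ω R} ‖θ(x̄ · mk(y diag t y⁻¹) · x̄⁻¹)‖ dμ' ≤ M_θ · (c · (C m · (3·(2(R + (6s+L)) + 1)²) · |Δ(t)|⁻¹)).toReal`, `Δ(t) = (t₀−t₁)(t₀−t₂)(t₁−t₂)`.
[cite: HarishChandra1970, Part VII §2 Theorem 18 p. 69; §3 p. 72] -/
theorem exists_setIntegral_norm_conj_le_split {E : Type*} [NormedAddCommGroup E]
    (Ω : ℕ → Set (GL (Fin 3) F ⧸ (Subgroup.zpowers (Units.mk0 ϖ hϖ0)).map (Matrix.GeneralLinearGroup.scalar (Fin 3))))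
    (hmem : ∀ (n : ℕ) (z : GL (Fin 3) F),
      (QuotientGroup.mk z : GL (Fin 3) F ⧸ (Subgroup.zpowers (Units.mk0 ϖ hϖ0)).map (Matrix.GeneralLinearGroup.scalar (Fin 3))) ∈ Ω n ↔
        ∀ i j k l, Valued.v (ϖ ^ n * ((z : Matrix (Fin 3) (Fin 3) F) i j * ((z⁻¹ : GL (Fin 3) F) : Matrix (Fin 3) (Fin 3) F) k l)) ≤ 1) :
    ∃ (c : ℝ≥0) (C : ℕ → ℝ≥0∞), (∀ m, C m ≠ ⊤) ∧
      ∀ (θ : GL (Fin 3) F ⧸ (Subgroup.zpowers (Units.mk0 ϖ hϖ0)).map (Matrix.GeneralLinearGroup.scalar (Fin 3)) → E) (Mθ : ℝ) (m : ℕ),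
        (∀ x, ‖θ x‖ ≤ Mθ) → (∀ x, x ∉ Ω m → θ x = 0) →
        ∀ (y : GL (Fin 3) F) (t : Fin 3 → Fˣ), (t 0 : F) ≠ t 1 → (t 0 : F) ≠ t 2 → (t 1 : F) ≠ t 2 → (∀ i, Valued.v (t i : F) ≤ 1) →
        ∀ (s L R : ℕ),
          (∀ i j k l, Valued.v (ϖ ^ s * (((y * glDiagonal 3 F t * y⁻¹ : GL (Fin 3) F) : Matrix (Fin 3) (Fin 3) F) i j *
            (((y * glDiagonal 3 F t * y⁻¹)⁻¹ : GL (Fin 3) F) : Matrix (Fin 3) (Fin 3) F) k l)) ≤ 1) →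
          Valued.v (ϖ ^ L * ((t 0 : F) * t 1 * t 2) ^ 2) ≤ Valued.v ((((t 0 : F) - t 1) * ((t 0 : F) - t 2) * ((t 1 : F) - t 2)) ^ 2) →
          ∫ x in Ω R, ‖θ (x * QuotientGroup.mk (y * glDiagonal 3 F t * y⁻¹) * x⁻¹)‖ ∂μ' ≤
            Mθ * ((c : ℝ≥0∞) * (C m * ((3 * (2 * (R + (6 * s + L)) + 1) ^ 2 : ℕ) : ℝ≥0∞) *
              ((normAbs F (((t 0 : F) - t 1) * ((t 0 : F) - t 2) * ((t 1 : F) - t 2)))⁻¹ : ℝ≥0))).toReal := by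
  -- a Haar measure upstairs
  haveI : T2Space F := (isLocalField F).toT2Space
  haveI : LocallyCompactSpace F := (isLocalField F).toLocallyCompactSpace
  haveI : IsTopologicalRing F := inferInstance
  haveI : LocallyCompactSpace (Matrix (Fin 3) (Fin 3) F) := inferInstanceAs (LocallyCompactSpace (Fin 3 → Fin 3 → F))
  haveI : LocallyCompactSpace (GL (Fin 3) F) := inferInstance
  set ν : Measure (GL (Fin 3) F) := Measure.haar with hν
  obtain ⟨c, hc⟩ := setIntegral_norm_comp_conj_le_adBall (E := E) hϖ hϖ0 ν μ' Ω hmem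
  obtain ⟨C, hC, hV⟩ := exists_measure_window_adBall_conj_le hϖ ν
  refine ⟨c, C, hC, fun θ Mθ m hM hsupp y t h01 h02 h12 ht1 s L R hs hL => ?_⟩
  -- 1. transfer to the upstairs count at `g = y diag t y⁻¹`
  refine (hc θ Mθ m hM hsupp (y * glDiagonal 3 F t * y⁻¹) R).trans ?_
  have hM0 : 0 ≤ Mθ := (norm_nonneg _).trans (hM 1)
  refine mul_le_mul_of_nonneg_left (ENNReal.toReal_mono ?_ ?_) hM0
  · exact ENNReal.mul_ne_top ENNReal.coe_ne_top (ENNReal.mul_ne_top (ENNReal.mul_ne_top (hC m) (ENNReal.natCast_ne_top _)) ENNReal.coe_ne_top)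
  gcongr
  -- 2. Theorem 18: a conjugator `y′ = y ϖ^e` of height `6s + L`
  obtain ⟨e, he⟩ := exists_adBall_mul_zpowDiagGL_of_adBall_conj hϖ hϖ0 (coe_glDiagonal 3 F t) hs hL
  have hg : y * glDiagonal 3 F t * y⁻¹ = (y * zpowDiagGL (n := 3) hϖ0 e) * glDiagonal 3 F t * (y * zpowDiagGL (n := 3) hϖ0 e)⁻¹ :=
    (mul_zpowDiagGL_conj_glDiagonal hϖ0 y t e).symm
  rw [hg]
  -- 3. the conjugator shift, 4. the split volume count
  set W : Finset ℤ := Finset.Icc (-2 : ℤ) 0 with hW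
  set hy : ℤ := WithZero.log (Valued.v (((y * zpowDiagGL (n := 3) hϖ0 e : GL (Fin 3) F)) : Matrix (Fin 3) (Fin 3) F).det) with hhy
  have hset : {z : GL (Fin 3) F | WithZero.log (Valued.v (z : Matrix (Fin 3) (Fin 3) F).det) ∈ Set.Icc (-2 : ℤ) 0 ∧
      (∀ i j k l, Valued.v (ϖ ^ R * ((z : Matrix (Fin 3) (Fin 3) F) i j * ((z⁻¹ : GL (Fin 3) F) : Matrix (Fin 3) (Fin 3) F) k l)) ≤ 1) ∧
      ∀ i j k l, Valued.v (ϖ ^ m * (((z * ((y * zpowDiagGL (n := 3) hϖ0 e) * glDiagonal 3 F t * (y * zpowDiagGL (n := 3) hϖ0 e)⁻¹) * z⁻¹ : GL (Fin 3) F) :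
        Matrix (Fin 3) (Fin 3) F) i j * (((z * ((y * zpowDiagGL (n := 3) hϖ0 e) * glDiagonal 3 F t * (y * zpowDiagGL (n := 3) hϖ0 e)⁻¹) * z⁻¹)⁻¹ : GL (Fin 3) F) :
        Matrix (Fin 3) (Fin 3) F) k l)) ≤ 1} =
      {z : GL (Fin 3) F | WithZero.log (Valued.v (z : Matrix (Fin 3) (Fin 3) F).det) ∈ W ∧
      (∀ i j k l, Valued.v (ϖ ^ R * ((z : Matrix (Fin 3) (Fin 3) F) i j * ((z⁻¹ : GL (Fin 3) F) : Matrix (Fin 3) (Fin 3) F) k l)) ≤ 1) ∧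
      ∀ i j k l, Valued.v (ϖ ^ m * (((z * ((y * zpowDiagGL (n := 3) hϖ0 e) * glDiagonal 3 F t * (y * zpowDiagGL (n := 3) hϖ0 e)⁻¹) * z⁻¹ : GL (Fin 3) F) :
        Matrix (Fin 3) (Fin 3) F) i j * (((z * ((y * zpowDiagGL (n := 3) hϖ0 e) * glDiagonal 3 F t * (y * zpowDiagGL (n := 3) hϖ0 e)⁻¹) * z⁻¹)⁻¹ : GL (Fin 3) F) :
        Matrix (Fin 3) (Fin 3) F) k l)) ≤ 1} := by
    ext z
    simp only [Set.mem_setOf_eq, hW, Set.mem_Icc, Finset.mem_Icc]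
  rw [hset]
  refine (measure_window_adBall_conj_conj_le_of_isHaarMeasure ν he (glDiagonal 3 F t) W R m).trans ?_
  refine (hV t h01 h02 h12 ht1 _ (R + (6 * s + L)) m).trans (le_of_eq ?_)
  rw [card_image_add_right, hW, Int.card_Icc, show ((0 : ℤ) + 1 - -2).toNat = 3 by decide]

end Summit.HodgeConjecture.HodgeConjecture.Cruxes.H413.K2E3GL3ModUniformizerBallBoundSplit

end
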